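import Mathlib.LinearAlgebra.Matrix.NonsingularInverse
import Mathlib.Analysis.Normed.Field.Basic
import HarnessLib

/-!
# BalabanUVNodes ∕ N15 — THE KING-MODEL RUNG (PART Ͻ-a): FINITE COVERS — THE DESCENT ENGINE: an operator on a covering space that preserves pulled-back functions
# DESCENDS to the base; descent is functorial (sums, products, powers, INVERSES) and the descended kernel is THE IMAGE SUM over the fibre
# (Track A, DAG node N15 = NE2; FAN-OUT v1.1 §N15 s3 «KING-MODEL RUNG … + what the curved case adds»; count-neutral)

HONEST FRAMING.  Count-neutral (cell `pub-ymgap`, seat `pub-ymgap-dag-n15-e` g45; `--supports stmt-QuantumFields-27247 --as helper` = K3ᴬ, KEY MAP v3).  Pure finite-dimensional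
linear algebra; no lattice, no field theory in this file.  It is the engine of PART Ͻ («finite covers»): King's [King1986] fine and block-spin operators at a toron on the torus
`T_K = Π_μℤ∕K_μ` are the DESCENTS of the same operators on a covering torus `T_{K′}` (`K_μ ∣ K′_μ`), where a toron whose holonomy has finite order becomes a pure gauge; the
method of images then carries the tree's `U = 1` theorems from the cover down to the toron.  NOT Bałaban's `G_k(U)`; NOT a node discharge (N15 of record untouched); nothing
continuum ∕ ℝ⁴ ∕ OS ∕ Clay.

THE NOTION.  For maps `πo : X′ → X` («output side») and `πi : Y′ → Y` («input side») a matrix `A : X′ × Y′` on the cover LIFTS a matrix `B : X × Y` on the base,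
`Lifts πo πi A B`, iff `A·(f ∘ πi) = (B·f) ∘ πo` for every `f : Y → R` — the cover operator maps pulled-back functions to pulled-back functions and acts on them as `B`.
This is the elementary periodisation principle (the method of images for a FINITE cover `T_{K′} → T_K`; cf. [Balaban1984PropagatorsI] (1.29) p.23, operators on the torus `T_η` as
periodic operators).  (King's §4 p.670 l.8–13 is a DIFFERENT reduction — box propagators to free-boundary-condition operators by [Ba 4]'s multiple reflections — and is not used here.)
PROVED HERE (all [folklore] linear algebra):
* §1 closure: `Lifts.zero`, `Lifts.one`, `Lifts.add`, `Lifts.sub`, `Lifts.neg`, `Lifts.smul`, ★ `Lifts.mul` (composition along a middle projection), `Lifts.pow`, `Lifts.diagonal_comp`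
  (a pulled-back multiplier lifts the multiplier), `Lifts.algebraMap`;
* §2 ★★ **`Lifts.apply_eq_sum_fiber`** — THE IMAGE SUM: `B(πo x̃, y) = Σ_{ỹ : πi ỹ = y} A(x̃, ỹ)` (any lift `x̃`), and the converse `lifts_of_apply_eq_sum_fiber`; hence
  `Lifts.unique` (a surjective `πo` determines `B`), `Lifts.sum_fiber_indep` (the fibre sum does not depend on the lift), ★ `Lifts.norm_apply_le` (`‖B(πo x̃,y)‖ ≤ Σ_{fibre}‖A(x̃,ỹ)‖`),
  `Lifts.map` (entrywise ring homomorphisms);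
* §3 ★★★ **`Lifts.isUnit`** ∕ **`Lifts.inv`** — DESCENT OF INVERSES: over a field, if `A` lifts `B` along a surjective `π` (square case) and `A` is invertible then `B` is
  invertible and `A⁻¹` lifts `B⁻¹`; so ★★ `Lifts.inv_apply_eq_sum_fiber`: `B⁻¹(π x̃, y) = Σ_{ỹ : π ỹ = y} A⁻¹(x̃, ỹ)` — the covariance on the base is the image sum of the
  covariance on the cover.
PRIOR TREE ART: none needed (Mathlib `Matrix.mulVec_mulVec`, `Matrix.ext_iff_mulVec`, `Matrix.mulVec_injective_iff_isUnit`, `Finset.sum_fiberwise`).  Dedup (rg at filing):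
basename 0 files; needles `Lifts πo|lifts_of_apply_eq_sum_fiber|apply_eq_sum_fiber` 0 tree files.  presearch: n/a (elementary linear algebra; [Balaban1984PropagatorsI] (1.29) p.23 cited
for the role of periodisation only).  0 `sorry`, 2 `def`.
v1.1 (DOC-ONLY, ERRATUM-Ͻ1 = ref-I READ-1034 N2): v1.0 cited «[King1986] §4 p.670 l.8–13» as «the method of images»; King's lines invoke [Ba 4]'s MULTIPLE-REFLECTION
representations (box propagators ∕ free boundary conditions ∕ the (2.13) operator on `ηℤ^d`, `A = 0`), not a periodisation — the finite-cover image sum is an elementary device of these files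
([folklore]); that locator is withdrawn from the affected docstrings, every other locator stands; declarations byte-identical to v1.0.
-/

noncomputable section

open scoped BigOperators
open Finset Matrix

namespace Summit.QuantumFields.YangMills.BalabanUVNodes.N15KingModelRung.Cover

universe u v w

variable {R : Type*} [CommRing R]
variable {X X' Y Y' Z Z' : Type*} [Fintype Y] [Fintype Y']

/-! ## §1 The notion and its closure properties -/

/-- `A` (a matrix on the COVER, `X′ × Y′`) LIFTS `B` (a matrix on the BASE, `X × Y`) along the projections `πo : X′ → X` (row∕output side) and `πi : Y′ → Y` (column∕input side):
applying `A` to a pulled-back function is pulling back `B` applied to the function, `A·(f ∘ πi) = (B·f) ∘ πo` (the method of images for a finite cover). [folklore] -/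
def Lifts (πo : X' → X) (πi : Y' → Y) (A : Matrix X' Y' R) (B : Matrix X Y R) : Prop :=
  ∀ f : Y → R, A *ᵥ (f ∘ πi) = (B *ᵥ f) ∘ πo

/-- THE FIBRE of a base point under a projection, as a `Finset` of the cover. [folklore] -/
def fiber [DecidableEq Y] (πi : Y' → Y) (y : Y) : Finset Y' := Finset.univ.filter fun y' => πi y' = y

omit [Fintype Y] in
/-- Membership in the fibre. [folklore] -/
@[simp] theorem mem_fiber [DecidableEq Y] (πi : Y' → Y) (y : Y) (y' : Y') : y' ∈ fiber πi y ↔ πi y' = y := by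
  simp [fiber]

variable {πo : X' → X} {πm : Z' → Z} {πi : Y' → Y}

/-- `0` lifts `0`. [folklore] -/
theorem Lifts.zero (πo : X' → X) (πi : Y' → Y) : Lifts πo πi (0 : Matrix X' Y' R) (0 : Matrix X Y R) := by
  intro f; simp [Matrix.zero_mulVec]

/-- `1` lifts `1` (square case, one projection). [folklore] -/
theorem Lifts.one [Fintype X] [Fintype X'] [DecidableEq X] [DecidableEq X'] (π : X' → X) : Lifts π π (1 : Matrix X' X' R) (1 : Matrix X X R) := by
  intro f; simp [Matrix.one_mulVec]

/-- Sums lift sums. [folklore] -/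
theorem Lifts.add {A A' : Matrix X' Y' R} {B B' : Matrix X Y R} (h : Lifts πo πi A B) (h' : Lifts πo πi A' B') :
    Lifts πo πi (A + A') (B + B') := by
  intro f; rw [Matrix.add_mulVec, Matrix.add_mulVec, h f, h' f]; rfl

/-- Negatives lift negatives. [folklore] -/
theorem Lifts.neg {A : Matrix X' Y' R} {B : Matrix X Y R} (h : Lifts πo πi A B) : Lifts πo πi (-A) (-B) := by
  intro f; rw [Matrix.neg_mulVec, Matrix.neg_mulVec, h f]; rfl

/-- Differences lift differences. [folklore] -/
theorem Lifts.sub {A A' : Matrix X' Y' R} {B B' : Matrix X Y R} (h : Lifts πo πi A B) (h' : Lifts πo πi A' B') :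
    Lifts πo πi (A - A') (B - B') := by
  rw [sub_eq_add_neg, sub_eq_add_neg]; exact h.add h'.neg

/-- Scalar multiples lift scalar multiples. [folklore] -/
theorem Lifts.smul {A : Matrix X' Y' R} {B : Matrix X Y R} (h : Lifts πo πi A B) (c : R) : Lifts πo πi (c • A) (c • B) := by
  intro f; rw [Matrix.smul_mulVec, Matrix.smul_mulVec, h f]; rfl

/-- ★ COMPOSITION: if `A` lifts `B` along `(πo, πm)` and `A′` lifts `B′` along `(πm, πi)` then `A·A′` lifts `B·B′` along `(πo, πi)`. [folklore] -/
theorem Lifts.mul [Fintype Z] [Fintype Z'] {A : Matrix X' Z' R} {A' : Matrix Z' Y' R} {B : Matrix X Z R} {B' : Matrix Z Y R}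
    (h : Lifts πo πm A B) (h' : Lifts πm πi A' B') : Lifts πo πi (A * A') (B * B') := by
  intro f
  rw [← Matrix.mulVec_mulVec, ← Matrix.mulVec_mulVec, h' f, h (B' *ᵥ f)]

/-- Powers lift powers (square case). [folklore] -/
theorem Lifts.pow [Fintype X] [Fintype X'] [DecidableEq X] [DecidableEq X'] {π : X' → X} {A : Matrix X' X' R} {B : Matrix X X R}
    (h : Lifts π π A B) (n : ℕ) :
    Lifts π π (A ^ n) (B ^ n) := by
  induction n with
  | zero => simpa using Lifts.one (R := R) π
  | succ n ih => rw [pow_succ, pow_succ]; exact ih.mul h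

/-- Scalars `c·1` lift scalars. [folklore] -/
theorem Lifts.algebraMap [Fintype X] [Fintype X'] [DecidableEq X] [DecidableEq X'] (π : X' → X) (c : R) :
    Lifts π π (algebraMap R (Matrix X' X' R) c) (algebraMap R (Matrix X X R) c) := by
  rw [Algebra.algebraMap_eq_smul_one, Algebra.algebraMap_eq_smul_one]
  exact (Lifts.one π).smul c

/-- A PULLED-BACK multiplier lifts the multiplier: `diagonal (g ∘ π)` lifts `diagonal g`. [folklore] -/
theorem Lifts.diagonal_comp [Fintype X] [Fintype X'] [DecidableEq X] [DecidableEq X'] (π : X' → X) (g : X → R) :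
    Lifts π π (Matrix.diagonal (g ∘ π)) (Matrix.diagonal g) := by
  intro f; funext x'
  simp [Matrix.mulVec_diagonal]

/-- Composition with a pulled-back multiplier on the right: if `A` lifts `B` then `A·diagonal(g ∘ πi)` lifts `B·diagonal g`. [folklore] -/
theorem Lifts.mul_diagonal [DecidableEq Y] [DecidableEq Y'] {A : Matrix X' Y' R} {B : Matrix X Y R} (h : Lifts πo πi A B) (g : Y → R) :
    Lifts πo πi (A * Matrix.diagonal (g ∘ πi)) (B * Matrix.diagonal g) :=
  h.mul (Lifts.diagonal_comp πi g)

/-- Composition with a pulled-back multiplier on the left. [folklore] -/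
theorem Lifts.diagonal_mul [Fintype X] [Fintype X'] [DecidableEq X] [DecidableEq X'] {A : Matrix X' Y' R} {B : Matrix X Y R}
    (h : Lifts πo πi A B) (g : X → R) :
    Lifts πo πi (Matrix.diagonal (g ∘ πo) * A) (Matrix.diagonal g * B) :=
  (Lifts.diagonal_comp πo g).mul h

/-! ## §2 The image sum -/

section ImageSum

variable [DecidableEq Y]

omit [Fintype Y] [Fintype Y'] in
/-- A pulled-back delta function is the indicator of the fibre: `(δ_y ∘ πi)(ỹ) = [πi ỹ = y]`. [folklore] -/
theorem single_comp_apply (y : Y) (y' : Y') : (Pi.single y (1 : R) ∘ πi) y' = if πi y' = y then 1 else 0 := by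
  simp only [Function.comp_apply, Pi.single_apply]

omit [Fintype Y] in
/-- The cover operator on a pulled-back delta function is the fibre sum of its kernel. [folklore] -/
theorem mulVec_single_comp (A : Matrix X' Y' R) (y : Y) (x' : X') :
    (A *ᵥ (Pi.single y (1 : R) ∘ πi)) x' = ∑ y' ∈ fiber πi y, A x' y' := by
  simp only [Matrix.mulVec, dotProduct, single_comp_apply, mul_ite, mul_one, mul_zero]
  rw [Finset.sum_ite, Finset.sum_const_zero, add_zero]
  rfl

/-- ★★ **THE IMAGE SUM**: if `A` lifts `B` then `B(πo x̃, y) = Σ_{ỹ : πi ỹ = y} A(x̃, ỹ)` for EVERY point `x̃` of the cover — the kernel on the base is the sum of the kernel on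
the cover over the fibre (the method of images for a finite cover). [folklore] -/
theorem Lifts.apply_eq_sum_fiber {A : Matrix X' Y' R} {B : Matrix X Y R} (h : Lifts πo πi A B) (x' : X') (y : Y) :
    B (πo x') y = ∑ y' ∈ fiber πi y, A x' y' := by
  have h1 := congrFun (h (Pi.single y 1)) x'
  rw [mulVec_single_comp, Function.comp_apply, Matrix.mulVec_single_one] at h1
  rw [h1]; rfl

/-- The fibre sums of a lifting kernel do not depend on the lift: `πo x̃ = πo x̃′ ⇒ Σ_{fibre} A(x̃, ·) = Σ_{fibre} A(x̃′, ·)`. [folklore] -/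
theorem Lifts.sum_fiber_indep {A : Matrix X' Y' R} {B : Matrix X Y R} (h : Lifts πo πi A B) {x' x'' : X'} (hx : πo x' = πo x'') (y : Y) :
    ∑ y' ∈ fiber πi y, A x' y' = ∑ y' ∈ fiber πi y, A x'' y' := by
  rw [← h.apply_eq_sum_fiber, ← h.apply_eq_sum_fiber, hx]

/-- THE CONVERSE: a kernel whose fibre sums are the pulled-back kernel of `B` lifts `B`. [folklore] -/
theorem lifts_of_apply_eq_sum_fiber {A : Matrix X' Y' R} {B : Matrix X Y R} (h : ∀ (x' : X') (y : Y), B (πo x') y = ∑ y' ∈ fiber πi y, A x' y') :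
    Lifts πo πi A B := by
  intro f; funext x'
  simp only [Matrix.mulVec, dotProduct, Function.comp_apply]
  rw [← Finset.sum_fiberwise Finset.univ πi (fun y' => A x' y' * f (πi y'))]
  refine Finset.sum_congr rfl fun y _ => ?_
  rw [h x' y, Finset.sum_mul]
  refine Finset.sum_congr rfl fun y' hy' => ?_
  rw [(mem_fiber πi y y').mp hy']

/-- The notion in kernel form (iff). [folklore] -/
theorem lifts_iff_apply_eq_sum_fiber {A : Matrix X' Y' R} {B : Matrix X Y R} (hπo : Function.Surjective πo) :
    Lifts πo πi A B ↔ ∀ (x' : X') (y : Y), B (πo x') y = ∑ y' ∈ fiber πi y, A x' y' :=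
  ⟨fun h x' y => h.apply_eq_sum_fiber x' y, fun h => by
    have _ := hπo
    exact lifts_of_apply_eq_sum_fiber h⟩

/-- ★ UNIQUENESS OF THE DESCENT: along a SURJECTIVE output projection a cover operator lifts at most one base operator. [folklore] -/
theorem Lifts.unique {A : Matrix X' Y' R} {B B' : Matrix X Y R} (hπo : Function.Surjective πo) (h : Lifts πo πi A B) (h' : Lifts πo πi A B') : B = B' := by
  ext x y
  obtain ⟨x', rfl⟩ := hπo x
  rw [h.apply_eq_sum_fiber, h'.apply_eq_sum_fiber]

/-- ★ ENTRY BOUNDS DESCEND: `‖B(πo x̃, y)‖ ≤ Σ_{fibre} ‖A(x̃, ỹ)‖` (seminormed coefficients). [folklore] -/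
theorem Lifts.norm_apply_le {S : Type*} [NormedCommRing S] {A : Matrix X' Y' S} {B : Matrix X Y S} (h : Lifts πo πi A B) (x' : X') (y : Y) :
    ‖B (πo x') y‖ ≤ ∑ y' ∈ fiber πi y, ‖A x' y'‖ := by
  rw [h.apply_eq_sum_fiber]; exact norm_sum_le _ _

/-- ★ A FIBREWISE MAJORANT DESCENDS: if `‖A(x̃,ỹ)‖ ≤ F(x̃,ỹ)` entrywise then `‖B(πo x̃, y)‖ ≤ Σ_{fibre} F(x̃, ỹ)`. [folklore] -/
theorem Lifts.norm_apply_le_sum {S : Type*} [NormedCommRing S] {A : Matrix X' Y' S} {B : Matrix X Y S} (h : Lifts πo πi A B) {F : X' → Y' → ℝ}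
    (hF : ∀ x' y', ‖A x' y'‖ ≤ F x' y') (x' : X') (y : Y) :
    ‖B (πo x') y‖ ≤ ∑ y' ∈ fiber πi y, F x' y' :=
  (h.norm_apply_le x' y).trans (Finset.sum_le_sum fun y' _ => hF x' y')

/-- Entrywise ring homomorphisms preserve lifting (along a surjective output projection). [folklore] -/
theorem Lifts.map {S : Type*} [CommRing S] {A : Matrix X' Y' R} {B : Matrix X Y R} (hπo : Function.Surjective πo) (h : Lifts πo πi A B) (φ : R →+* S) :
    Lifts πo πi (A.map φ) (B.map φ) := by
  refine lifts_of_apply_eq_sum_fiber fun x' y => ?_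
  have _ := hπo
  rw [Matrix.map_apply, h.apply_eq_sum_fiber, map_sum]
  rfl

end ImageSum

/-! ## §3 Descent of inverses -/

section Inverse

variable {𝕜 : Type*} [Field 𝕜] {π : X' → X}

/-- Pull-back along a surjection is injective on functions. [folklore] -/
theorem comp_injective_of_surjective {S : Type*} (hπ : Function.Surjective π) {f g : X → S} (h : f ∘ π = g ∘ π) : f = g := by
  funext x
  obtain ⟨x', rfl⟩ := hπ x
  exact congrFun h x'

variable [Fintype X] [Fintype X'] [DecidableEq X] [DecidableEq X']

/-- ★★★ **INVERTIBILITY DESCENDS**: if `A` lifts `B` along a surjective `π` and `A` is invertible then `B` is invertible (`B·f = 0 ⇒ A·(f∘π) = 0 ⇒ f∘π = 0 ⇒ f = 0`). [folklore] -/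
theorem Lifts.isUnit {A : Matrix X' X' 𝕜} {B : Matrix X X 𝕜} (hπ : Function.Surjective π) (h : Lifts π π A B) (hA : IsUnit A) : IsUnit B := by
  rw [← Matrix.mulVec_injective_iff_isUnit]
  have hAi := Matrix.mulVec_injective_iff_isUnit.mpr hA
  intro f g hfg
  have h1 : A *ᵥ (f ∘ π) = A *ᵥ (g ∘ π) := by rw [h f, h g, hfg]
  exact comp_injective_of_surjective hπ (hAi h1)

/-- ★★★ **THE INVERSE DESCENDS**: if `A` lifts `B` along a surjective `π` and `A` is invertible then `A⁻¹` lifts `B⁻¹`. [folklore] -/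
theorem Lifts.inv {A : Matrix X' X' 𝕜} {B : Matrix X X 𝕜} (hπ : Function.Surjective π) (h : Lifts π π A B) (hA : IsUnit A) : Lifts π π A⁻¹ B⁻¹ := by
  have hB : IsUnit B := h.isUnit hπ hA
  have hAd : IsUnit A.det := (Matrix.isUnit_iff_isUnit_det A).mp hA
  have hBd : IsUnit B.det := (Matrix.isUnit_iff_isUnit_det B).mp hB
  intro f
  have h1 : A *ᵥ ((B⁻¹ *ᵥ f) ∘ π) = f ∘ π := by
    rw [h (B⁻¹ *ᵥ f), Matrix.mulVec_mulVec, Matrix.mul_nonsing_inv B hBd, Matrix.one_mulVec]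
  have h2 := congrArg (fun v => A⁻¹ *ᵥ v) h1
  simp only [Matrix.mulVec_mulVec, Matrix.nonsing_inv_mul A hAd, Matrix.one_mulVec] at h2
  exact h2.symm

/-- ★★ **THE COVARIANCE ON THE BASE IS THE IMAGE SUM OF THE COVARIANCE ON THE COVER**: `B⁻¹(π x̃, y) = Σ_{ỹ : π ỹ = y} A⁻¹(x̃, ỹ)`. [folklore] -/
theorem Lifts.inv_apply_eq_sum_fiber {A : Matrix X' X' 𝕜} {B : Matrix X X 𝕜} (hπ : Function.Surjective π) (h : Lifts π π A B) (hA : IsUnit A) (x' : X') (y : X) :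
    B⁻¹ (π x') y = ∑ y' ∈ fiber π y, A⁻¹ x' y' :=
  (h.inv hπ hA).apply_eq_sum_fiber x' y

/-- Invertibility descends in `det` form. [folklore] -/
theorem Lifts.isUnit_det {A : Matrix X' X' 𝕜} {B : Matrix X X 𝕜} (hπ : Function.Surjective π) (h : Lifts π π A B) (hA : IsUnit A.det) : IsUnit B.det :=
  (Matrix.isUnit_iff_isUnit_det B).mp (h.isUnit hπ ((Matrix.isUnit_iff_isUnit_det A).mpr hA))

/-- A sandwich `P·A⁻¹·Q` descends to `P′·B⁻¹·Q′` when the three factors lift (the shape of King's `Q G Q^*`, [King1986] (2.14) p.653). [folklore] -/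
theorem Lifts.sandwich_inv {W W' V V' : Type*} [Fintype W] [Fintype W'] [Fintype V] [Fintype V'] {πW : W' → W} {πV : V' → V}
    {P : Matrix W' X' 𝕜} {P' : Matrix W X 𝕜} {A : Matrix X' X' 𝕜} {B : Matrix X X 𝕜} {Q : Matrix X' V' 𝕜} {Q' : Matrix X V 𝕜}
    (hπ : Function.Surjective π) (hP : Lifts πW π P P') (hA : Lifts π π A B) (hQ : Lifts π πV Q Q') (hu : IsUnit A) :
    Lifts πW πV (P * A⁻¹ * Q) (P' * B⁻¹ * Q') :=
  (hP.mul (hA.inv hπ hu)).mul hQ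

end Inverse

end Summit.QuantumFields.YangMills.BalabanUVNodes.N15KingModelRung.Cover

end
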